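import Summits.CriticalPhenomena.PercolationContinuityZ3.Theorems.PercNearOneGluingAdditiveGluingExchangeRatioFibres

/-!
# `PercNearOneGluing` · crux `AdditiveGluing` (stmt-CriticalPhenomena-4576) · line `peel` · strategy (a):
# wins MEDIATED by the inserted relay grow under gluing

Support file (`--supports stmt-CriticalPhenomena-4576`); no definitions, no named facts.

In the exchange-surplus decomposition of the two-relay pair step (`…ExchangeSurplus.lean`, evidence note `PEEL-A-RelayInsertion.md` §4b)
one nonnegative piece is the ratio-monotonicity of the wins MEDIATED by the new relay `a₁`,
`WIN₁⁻(X) = μ(a₀ ↮ X, a₁ ↔ b, X ↔ a₁)` (the right-hand side of the landed exchange-ratio inequality `exchangeRatio_liveFail_le`).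
This file proves its growth under gluing a bystander `x` onto the observer `s` (`S = {s, x}`):

* `mediatedWin_growth`: `WIN₁⁻(S) · μ(a₀ ↮ s) ≥ WIN₁⁻(s) · μ(a₀ ↮ s, a₀ ↮ x)` — BHK 2006 Thm 1.3 (antitone × antitone) on the fibres of
  `C(a₀)` inside `{a₀ ↮ s}` with `g(W) = 1{b, a₁ ∉ W}·μ(s ↔ a₁ ∧ a₁ ↔ b off W)` and `1{x ∉ W}`;
i.e. the mediated wins grow at least by the factor `θ = μ(a₀↮S)/μ(a₀↮s)` by which the losing mass shrinks
(`μ(a₀↔b, a₀↮S)·μ(a₀↮s) ≤ μ(a₀↔b, a₀↮s)·μ(a₀↮S)`, `goodStaysGood_core`'s first step), so the odds of beating `a₀` THROUGH `a₁`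
improve under gluing exactly as the plain odds do (`pairStep_odds`).
[cite: VandenbergHaggstromKahn2005, Thm. 1.3 (p. 6); KozmaNitzan2024, Lemma 1 (pp. 5–6), §3.2 pp. 12–14]
-/

namespace Summit.CriticalPhenomena.PercolationContinuityZ3.Theorems

open MeasureTheory Set
open Literature.Probability.LatticeModels (prodBernoulli)
open Literature.Probability.Percolation (BondConfig openConn openConnIn openGraph openCluster)

noncomputable section
open Classical
open scoped BigOperators

variable {n : ℕ}

/-- The BHK conditioning set with `X = {s}` is `{a₀ ↮ s}` (as an intersection-friendly set). [folklore] -/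
theorem medWin_D_eq (a₀ s : Fin n) :
    {ω : BondConfig (Fin n) | ∀ y ∈ ({s} : Set (Fin n)), ¬ (openGraph ω).Reachable a₀ y} =
      (openConn a₀ s : Set (BondConfig (Fin n)))ᶜ :=
  exch_D_singleton a₀ s

/-- `g(W) = 1{b ∉ W}·1{a₁ ∉ W}·μ(s ↔ a₁ ∧ a₁ ↔ b off W)` is antitone. [folklore] -/
theorem medWin_g_anti (u : Sym2 (Fin n) → unitInterval) (b a₁ s : Fin n) :
    Antitone fun W : Finset (Fin n) =>
      (if b ∈ W then (0 : ℝ) else 1) * ((if a₁ ∈ W then (0 : ℝ) else 1) *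
        (prodBernoulli u).real ((openConnIn ((W : Set (Fin n)))ᶜ s a₁ : Set (BondConfig (Fin n))) ∩
          openConnIn ((W : Set (Fin n)))ᶜ a₁ b)) := by
  intro W W' h
  have hg : (prodBernoulli u).real ((openConnIn ((W' : Set (Fin n)))ᶜ s a₁ : Set (BondConfig (Fin n))) ∩
        openConnIn ((W' : Set (Fin n)))ᶜ a₁ b) ≤
      (prodBernoulli u).real ((openConnIn ((W : Set (Fin n)))ᶜ s a₁ : Set (BondConfig (Fin n))) ∩
        openConnIn ((W : Set (Fin n)))ᶜ a₁ b) := by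
    have h1 := goodStaysGood_g_anti u ({s} : Finset (Fin n)) a₁ h
    have h2 := goodStaysGood_g_anti u ({a₁} : Finset (Fin n)) b h
    simp only [Finset.mem_singleton, Set.iUnion_iUnion_eq_left] at h1 h2
    refine measureReal_mono (fun ω hω => ?_) (measure_ne_top _ _)
    have hc : ((W' : Set (Fin n)))ᶜ ⊆ ((W : Set (Fin n)))ᶜ := Set.compl_subset_compl.2 (Finset.coe_subset.2 h)
    rcases hω with ⟨⟨hx, hy, hr⟩, ⟨hx', hy', hr'⟩⟩
    exact ⟨⟨hc hx, hc hy, hr.map (SimpleGraph.induceHomOfLE (G := openGraph ω) hc).toHom⟩,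
      ⟨hc hx', hc hy', hr'.map (SimpleGraph.induceHomOfLE (G := openGraph ω) hc).toHom⟩⟩
  exact mul_le_mul (goodStaysGood_psi_anti b h) (mul_le_mul (goodStaysGood_psi_anti a₁ h) hg measureReal_nonneg
    (by split_ifs <;> norm_num)) (mul_nonneg (by split_ifs <;> norm_num) measureReal_nonneg) (by split_ifs <;> norm_num)

/-- **Fibre form of the mediated win**: on `{C(a₀) = W}` inside `{a₀ ↮ s}`,
`g(W) · μ({a₀↮s} ∩ {C(a₀)=W}) = μ({C(a₀)=W} ∩ ({a₀↮s} ∩ {s↔a₁} ∩ {a₁↔b}))`. [folklore] -/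
theorem medWin_fib (u : Sym2 (Fin n) → unitInterval) (b a₀ a₁ s : Fin n) (W : Finset (Fin n)) :
    ((if b ∈ W then (0 : ℝ) else 1) * ((if a₁ ∈ W then (0 : ℝ) else 1) *
        (prodBernoulli u).real ((openConnIn ((W : Set (Fin n)))ᶜ s a₁ : Set (BondConfig (Fin n))) ∩
          openConnIn ((W : Set (Fin n)))ᶜ a₁ b))) *
        (prodBernoulli u).real ((openConn a₀ s : Set (BondConfig (Fin n)))ᶜ ∩
          {ω : BondConfig (Fin n) | openCluster ω a₀ = (W : Set (Fin n))}) =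
      (prodBernoulli u).real ({ω : BondConfig (Fin n) | openCluster ω a₀ = (W : Set (Fin n))} ∩
        ((openConn a₀ s : Set (BondConfig (Fin n)))ᶜ ∩ (openConn s a₁ : Set (BondConfig (Fin n))) ∩
          (openConn a₁ b : Set (BondConfig (Fin n))))) := by
  set Φ : Set (BondConfig (Fin n)) := {ω | openCluster ω a₀ = (W : Set (Fin n))} with hΦ
  by_cases ha₀ : a₀ ∈ W
  swap
  · rw [hΦ, offObs_fib_eq_empty a₀ W ha₀, Set.inter_empty, Set.empty_inter, measureReal_empty, mul_zero]
  by_cases hs : s ∈ W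
  · have h1 : (openConn a₀ s : Set (BondConfig (Fin n)))ᶜ ∩ Φ = ∅ := Set.ext fun ω => by
      simp only [Set.mem_inter_iff, Set.mem_compl_iff, Set.mem_empty_iff_false, iff_false, not_and]
      exact fun h hF => h (offObs_fib_subset_openConn a₀ s W hs hF)
    have h2 : Φ ∩ ((openConn a₀ s : Set (BondConfig (Fin n)))ᶜ ∩ (openConn s a₁ : Set (BondConfig (Fin n))) ∩
        (openConn a₁ b : Set (BondConfig (Fin n)))) = ∅ := Set.ext fun ω => by
      simp only [Set.mem_inter_iff, Set.mem_compl_iff, Set.mem_empty_iff_false, iff_false, not_and]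
      intro hF h _
      exact absurd (offObs_fib_subset_openConn a₀ s W hs hF) h.1
    rw [h1, h2, measureReal_empty, mul_zero]
  have hNs : (openConn a₀ s : Set (BondConfig (Fin n)))ᶜ ∩ Φ = Φ :=
    Set.inter_eq_right.2 (offObs_fib_subset_compl_openConn a₀ s W hs)
  rw [hNs]
  -- if `b ∈ W` or `a₁ ∈ W` the target event misses the fibre (it would force `a₀ ↔ s`)
  have hempty : ∀ y : Fin n, y ∈ W → (y = b ∨ y = a₁) →
      Φ ∩ ((openConn a₀ s : Set (BondConfig (Fin n)))ᶜ ∩ (openConn s a₁ : Set (BondConfig (Fin n))) ∩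
        (openConn a₁ b : Set (BondConfig (Fin n)))) = ∅ := by
    intro y hy hyb
    refine Set.ext fun ω => ?_
    simp only [Set.mem_inter_iff, Set.mem_compl_iff, Set.mem_empty_iff_false, iff_false, not_and]
    intro hF h h1b
    have h0y : (openGraph ω).Reachable a₀ y := offObs_fib_subset_openConn a₀ y W hy hF
    have hsa' : (openGraph ω).Reachable s a₁ := h.2
    have h1b' : (openGraph ω).Reachable a₁ b := h1b
    rcases hyb with rfl | rfl
    · exact h.1 (h0y.trans ((SimpleGraph.Reachable.symm h1b').trans (SimpleGraph.Reachable.symm hsa')))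
    · exact h.1 (h0y.trans (SimpleGraph.Reachable.symm hsa'))
  by_cases hb : b ∈ W
  · rw [if_pos hb, zero_mul, zero_mul, hempty b hb (Or.inl rfl), measureReal_empty]
  by_cases ha₁ : a₁ ∈ W
  · rw [if_pos ha₁, zero_mul, mul_zero, zero_mul, hempty a₁ ha₁ (Or.inr rfl), measureReal_empty]
  rw [if_neg hb, if_neg ha₁, one_mul, one_mul]
  have hdet := (offObs_determinedBy_openConnIn_compl W s a₁).inter (offObs_determinedBy_openConnIn_compl W a₁ b)
  have hB : Φ ∩ ((openConn a₀ s : Set (BondConfig (Fin n)))ᶜ ∩ (openConn s a₁ : Set (BondConfig (Fin n))) ∩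
        (openConn a₁ b : Set (BondConfig (Fin n)))) =
      Φ ∩ ((openConnIn ((W : Set (Fin n)))ᶜ s a₁ : Set (BondConfig (Fin n))) ∩ openConnIn ((W : Set (Fin n)))ᶜ a₁ b) := by
    have k1 := goodPM_cluster_inter_openConn a₀ s a₁ W hs
    have k2 := goodPM_cluster_inter_openConn a₀ a₁ b W ha₁
    ext ω
    simp only [Set.mem_inter_iff, Set.mem_compl_iff]
    constructor
    · rintro ⟨hF, ⟨-, hsa⟩, h1b⟩
      have m1 : ω ∈ Φ ∩ openConnIn ((W : Set (Fin n)))ᶜ s a₁ := by rw [← k1]; exact ⟨hF, hsa⟩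
      have m2 : ω ∈ Φ ∩ openConnIn ((W : Set (Fin n)))ᶜ a₁ b := by rw [← k2]; exact ⟨hF, h1b⟩
      exact ⟨hF, m1.2, m2.2⟩
    · rintro ⟨hF, hsa, h1b⟩
      exact ⟨hF, ⟨offObs_fib_subset_compl_openConn a₀ s W hs hF,
        Literature.Probability.Percolation.openConnIn_subset_openConn _ s a₁ hsa⟩,
        Literature.Probability.Percolation.openConnIn_subset_openConn _ a₁ b h1b⟩
  rw [hB, offObs_fibre_inter u a₀ W ha₀ _ hdet, mul_comm]

/-- The same with the bystander's indicator `1{x ∉ W}`: the event gains `{a₀ ↮ x}`. [folklore] -/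
theorem medWin_fib_x (u : Sym2 (Fin n) → unitInterval) (b a₀ a₁ s x : Fin n) (W : Finset (Fin n)) :
    (((if b ∈ W then (0 : ℝ) else 1) * ((if a₁ ∈ W then (0 : ℝ) else 1) *
        (prodBernoulli u).real ((openConnIn ((W : Set (Fin n)))ᶜ s a₁ : Set (BondConfig (Fin n))) ∩
          openConnIn ((W : Set (Fin n)))ᶜ a₁ b))) * (if x ∈ W then (0 : ℝ) else 1)) *
        (prodBernoulli u).real ((openConn a₀ s : Set (BondConfig (Fin n)))ᶜ ∩
          {ω : BondConfig (Fin n) | openCluster ω a₀ = (W : Set (Fin n))}) =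
      (prodBernoulli u).real ({ω : BondConfig (Fin n) | openCluster ω a₀ = (W : Set (Fin n))} ∩
        (((openConn a₀ s : Set (BondConfig (Fin n)))ᶜ ∩ (openConn s a₁ : Set (BondConfig (Fin n))) ∩
          (openConn a₁ b : Set (BondConfig (Fin n)))) ∩ (openConn a₀ x : Set (BondConfig (Fin n)))ᶜ)) := by
  rw [mul_assoc, mul_comm (if x ∈ W then (0 : ℝ) else 1), ← mul_assoc, medWin_fib u b a₀ a₁ s W, mul_comm,
    ← goodStaysGood_fib_inter_notConn u a₀ x W]


/-- **Mediated wins grow under gluing (fibre form).**  For `a₀ ≠ s` and any `x`: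
`μ(a₀↮s, s↔a₁, a₁↔b) · μ(a₀↮s, a₀↮x) ≤ μ(a₀↮s) · μ(a₀↮s, s↔a₁, a₁↔b, a₀↮x)` — BHK 2006 Thm 1.3 for the antitone pair
`g(W) = 1{b,a₁ ∉ W}·μ(s↔a₁ ∧ a₁↔b off W)`, `1{x ∉ W}` on the fibres of `C(a₀)` inside `{a₀ ↮ s}`.
[cite: VandenbergHaggstromKahn2005, Thm. 1.3 (p. 6)] -/
theorem mediatedWin_growth (u : Sym2 (Fin n) → unitInterval) (b a₀ a₁ s x : Fin n) (h0s : a₀ ≠ s) :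
    (prodBernoulli u).real ((openConn a₀ s : Set (BondConfig (Fin n)))ᶜ ∩ (openConn s a₁ : Set (BondConfig (Fin n))) ∩
          (openConn a₁ b : Set (BondConfig (Fin n)))) *
        (prodBernoulli u).real ((openConn a₀ s : Set (BondConfig (Fin n)))ᶜ ∩ (openConn a₀ x : Set (BondConfig (Fin n)))ᶜ) ≤
      (prodBernoulli u).real ((openConn a₀ s : Set (BondConfig (Fin n)))ᶜ) *
        (prodBernoulli u).real ((((openConn a₀ s : Set (BondConfig (Fin n)))ᶜ ∩ (openConn s a₁ : Set (BondConfig (Fin n))) ∩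
          (openConn a₁ b : Set (BondConfig (Fin n)))) ∩ (openConn a₀ x : Set (BondConfig (Fin n)))ᶜ)) := by
  have hs : a₀ ∉ ({s} : Set (Fin n)) := by simpa using h0s
  have bhk := offObs_bhk_anti_anti u a₀ ({s} : Set (Fin n)) hs
    (fun W : Finset (Fin n) => (if b ∈ W then (0 : ℝ) else 1) * ((if a₁ ∈ W then (0 : ℝ) else 1) *
      (prodBernoulli u).real ((openConnIn ((W : Set (Fin n)))ᶜ s a₁ : Set (BondConfig (Fin n))) ∩
        openConnIn ((W : Set (Fin n)))ᶜ a₁ b)))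
    (fun W : Finset (Fin n) => if x ∈ W then (0 : ℝ) else 1)
    (medWin_g_anti u b a₁ s) (goodStaysGood_psi_anti x)
  rw [medWin_D_eq] at bhk
  have hS1 : ∑ W : Finset (Fin n), ((if b ∈ W then (0 : ℝ) else 1) * ((if a₁ ∈ W then (0 : ℝ) else 1) *
        (prodBernoulli u).real ((openConnIn ((W : Set (Fin n)))ᶜ s a₁ : Set (BondConfig (Fin n))) ∩
          openConnIn ((W : Set (Fin n)))ᶜ a₁ b))) *
      (prodBernoulli u).real ((openConn a₀ s : Set (BondConfig (Fin n)))ᶜ ∩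
        {ω : BondConfig (Fin n) | openCluster ω a₀ = (W : Set (Fin n))}) =
      (prodBernoulli u).real ((openConn a₀ s : Set (BondConfig (Fin n)))ᶜ ∩ (openConn s a₁ : Set (BondConfig (Fin n))) ∩
        (openConn a₁ b : Set (BondConfig (Fin n)))) := by
    rw [← offObs_sum_fib_inter u a₀]
    exact Finset.sum_congr rfl fun W _ => medWin_fib u b a₀ a₁ s W
  have hS2 := goodStaysGood_sum_notConn u a₀ x ((openConn a₀ s : Set (BondConfig (Fin n)))ᶜ)
  have hS3 : ∑ W : Finset (Fin n), (((if b ∈ W then (0 : ℝ) else 1) * ((if a₁ ∈ W then (0 : ℝ) else 1) *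
        (prodBernoulli u).real ((openConnIn ((W : Set (Fin n)))ᶜ s a₁ : Set (BondConfig (Fin n))) ∩
          openConnIn ((W : Set (Fin n)))ᶜ a₁ b))) * (if x ∈ W then (0 : ℝ) else 1)) *
      (prodBernoulli u).real ((openConn a₀ s : Set (BondConfig (Fin n)))ᶜ ∩
        {ω : BondConfig (Fin n) | openCluster ω a₀ = (W : Set (Fin n))}) =
      (prodBernoulli u).real ((((openConn a₀ s : Set (BondConfig (Fin n)))ᶜ ∩ (openConn s a₁ : Set (BondConfig (Fin n))) ∩
        (openConn a₁ b : Set (BondConfig (Fin n)))) ∩ (openConn a₀ x : Set (BondConfig (Fin n)))ᶜ)) := by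
    rw [← offObs_sum_fib_inter u a₀]
    exact Finset.sum_congr rfl fun W _ => medWin_fib_x u b a₀ a₁ s x W
  rw [hS1, hS2, hS3] at bhk
  exact bhk

/-- **Mediated wins grow under gluing (pair form).**  For the pair `S = {s, x}`:
`μ(a₀↮s, s↔a₁↔b) · μ(a₀↮s, a₀↮x) ≤ μ(a₀↮s) · μ(a₀↮s, a₀↮x, (s↔a₁ ∨ x↔a₁), a₁↔b)`, i.e.
`WIN₁⁻(S)/WIN₁⁻(s) ≥ θ := μ(a₀↮S)/μ(a₀↮s)` — the factor by which the losing mass shrinks (`LOSE(S) ≤ θ·LOSE(s)`), so the odds of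
beating the designated relay THROUGH `a₁` improve under gluing, as the plain odds do (`pairStep_odds`); this is the BHK-provable piece
`M^{WIN₁⁻} ≥ 0` of the exchange-surplus decomposition. [cite: VandenbergHaggstromKahn2005, Thm. 1.3 (p. 6); KozmaNitzan2024, §3.2 pp. 12–14] -/
theorem mediatedWin_pairGrowth (u : Sym2 (Fin n) → unitInterval) (b a₀ a₁ s x : Fin n) (h0s : a₀ ≠ s) :
    (prodBernoulli u).real ((openConn a₀ s : Set (BondConfig (Fin n)))ᶜ ∩ (openConn s a₁ : Set (BondConfig (Fin n))) ∩
          (openConn a₁ b : Set (BondConfig (Fin n)))) *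
        (prodBernoulli u).real ((openConn a₀ s : Set (BondConfig (Fin n)))ᶜ ∩ (openConn a₀ x : Set (BondConfig (Fin n)))ᶜ) ≤
      (prodBernoulli u).real ((openConn a₀ s : Set (BondConfig (Fin n)))ᶜ) *
        (prodBernoulli u).real ((openConn a₀ s : Set (BondConfig (Fin n)))ᶜ ∩ (openConn a₀ x : Set (BondConfig (Fin n)))ᶜ ∩
          ((openConn s a₁ : Set (BondConfig (Fin n))) ∪ (openConn x a₁ : Set (BondConfig (Fin n)))) ∩
            (openConn a₁ b : Set (BondConfig (Fin n)))) := by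
  refine (mediatedWin_growth u b a₀ a₁ s x h0s).trans (mul_le_mul_of_nonneg_left ?_ measureReal_nonneg)
  refine measureReal_mono ?_ (measure_ne_top _ _)
  rintro ω ⟨⟨⟨h0s', hsa⟩, h1b⟩, h0x⟩
  exact ⟨⟨⟨h0s', h0x⟩, Or.inl hsa⟩, h1b⟩

/-- **STUB `stub_mediatedWinGrowth_a` (registered rung of strategy (a)) = `mediatedWin_pairGrowth` by name and signature.**
[cite: VandenbergHaggstromKahn2005, Thm. 1.3 (p. 6); KozmaNitzan2024, §3.2 pp. 12–14] -/
theorem stub_mediatedWinGrowth_a :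
    ∀ (n : ℕ) (u : Sym2 (Fin n) → unitInterval) (b a₀ a₁ s x : Fin n), a₀ ≠ s →
      (prodBernoulli u).real ((openConn a₀ s)ᶜ ∩ openConn s a₁ ∩ openConn a₁ b)
          * (prodBernoulli u).real ((openConn a₀ s)ᶜ ∩ (openConn a₀ x)ᶜ)
        ≤ (prodBernoulli u).real (openConn a₀ s)ᶜ
          * (prodBernoulli u).real ((openConn a₀ s)ᶜ ∩ (openConn a₀ x)ᶜ ∩ (openConn s a₁ ∪ openConn x a₁) ∩ openConn a₁ b) :=
  fun _ u b a₀ a₁ s x h0s => mediatedWin_pairGrowth u b a₀ a₁ s x h0s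

end

end Summit.CriticalPhenomena.PercolationContinuityZ3.Theorems
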